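import Summits.ResolutionOfSingularities.ResolutionOfSingularities.Theorems.PurelyInseparableDim4LeafStep
import HarnessLib
import HarnessLib.Audit.Tags

/-!
# Purely inseparable fourfolds — «d = 0 LEAF» steps: the shade stays `0`, the order drops, and
# NO INFINITE FIBRE CHAIN starts at a leaf (cell res-dim4-pi, WORD #38 (a)(2), sequel)
# [OURS · counted 0 · a statement about OUR coordinate-centre frame, not about resolution]

Sequel of `PurelyInseparableDim4LeafStep` (width seat `res-dim4-p-10` g2).  From `leafStep_fibre`
(a cardinality-first centre of a leaf, an equimultiple point of the FIBRE over the origin ⇒ a leaf with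
`|r'| < |r|`): the shade of the successor is `0` (`shade_step_eq_zero`), `ord₀` drops
(`ordZero_step_lt`), the class-vocabulary form over `IsMode1hCentre` (`leafStep_fibre_mode1h`), and
**`no_infinite_fibre_chain`**: no infinite sequence of MODE-1h fibre steps starts at a leaf — the
theorem behind the engines' convention «monomial(d = 0) = A-WIN» for FIBRE replies.  It says nothing
about replies ALONG the centre (see the specimens file): not a row rule for `InScopeWinCert`.
Nothing here proves resolution of singularities in dimension ≥ 4 / characteristic `p`; counted 0; AI
work, weaker than expert review. bears_on: LADDER-RESOLUTION:D157-DOOR2 (res-dim4-pi · WORD #38 (a)(2)).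
Supports stmt-ResolutionOfSingularities-16155 (helper).
-/

set_option linter.dupNamespace false

open MvPolynomial Finset

open scoped BigOperators

noncomputable section

namespace Summit.ResolutionOfSingularities.ResolutionOfSingularities.Theorems.PIDim4

namespace LeafStep

open Literature.AlgebraicGeometry.Resolution
open Literature.AlgebraicGeometry.Resolution.Hauser2010
open CentreBlowup

section General

variable {σ : Type*} [Fintype σ] [DecidableEq σ] {K : Type*} [Field K] [DecidableEq K]

/-! ## 1. Shade and order across a leaf step -/

/-- **The shade stays `0`** across a leaf step in the fibre. [folklore] -/
theorem shade_step_eq_zero {q : ℕ} (hq : 0 < q) {S : Finset σ} {j : σ} (hj : j ∈ S) {b : σ → K}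
    (hbj : b j = 0) (hfib : ∀ i, i ∉ S → b i = 0) (s : CState σ K)
    (hdiv : ∀ d ∈ s.F.support, s.r ≤ d) (hd0 : coeff s.r s.F ≠ 0) (hcl : ¬ ∀ i, q ∣ s.r i)
    (hperm : (q : ℕ∞) ≤ ordAlong S s.F)
    (hleast : ∀ S' : Finset σ, S'.Nonempty → (q : ℕ∞) ≤ ordAlong S' s.F → S.card ≤ S'.card)
    (heq : IsEquimultiplePoint q S j b s) : (step q S j b s).shade = 0 := by
  obtain ⟨h1, h2, -, -⟩ := leafStep_fibre hq hj hbj hfib s hdiv hd0 hcl hperm hleast heq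
  exact shade_eq_zero _ h1 h2

/-- **The order drops**: `ord₀ F' < ord₀ F` across a leaf step in the fibre. [folklore] -/
theorem ordZero_step_lt {q : ℕ} (hq : 0 < q) {S : Finset σ} {j : σ} (hj : j ∈ S) {b : σ → K}
    (hbj : b j = 0) (hfib : ∀ i, i ∉ S → b i = 0) (s : CState σ K)
    (hdiv : ∀ d ∈ s.F.support, s.r ≤ d) (hd0 : coeff s.r s.F ≠ 0) (hcl : ¬ ∀ i, q ∣ s.r i)
    (hperm : (q : ℕ∞) ≤ ordAlong S s.F)
    (hleast : ∀ S' : Finset σ, S'.Nonempty → (q : ℕ∞) ≤ ordAlong S' s.F → S.card ≤ S'.card)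
    (heq : IsEquimultiplePoint q S j b s) : ordZero (step q S j b s).F < ordZero s.F := by
  obtain ⟨h1, h2, -, h4⟩ := leafStep_fibre hq hj hbj hfib s hdiv hd0 hcl hperm hleast heq
  rw [ordZero_eq_degree _ h1 h2, ordZero_eq_degree s hdiv hd0]
  exact_mod_cast h4

end General


/-! ## 2. The class of record (`σ = Fin 4`): MODE-1h centres, no infinite fibre chain -/

section ClassOfRecord

variable {K : Type} [Field K] [DecidableEq K]

/-- **LEAF STEP, MODE 1h (class vocabulary).** For a leaf `s : State K`, a MODE-1h centre `S`
(`IsMode1hCentre`: Hironaka-permissible of least cardinality), a chart `j ∈ S` and an equimultiple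
FIBRE point `b`, the successor is a leaf with `|r'| < |r|`. [OURS · counted 0] [folklore] -/
theorem leafStep_fibre_mode1h {q : ℕ} (hq : 0 < q) {S : Finset (Fin 4)} {j : Fin 4} (hj : j ∈ S)
    {b : Fin 4 → K} (hbj : b j = 0) (hfib : ∀ i, i ∉ S → b i = 0) (s : State K)
    (hdiv : ∀ d ∈ s.F.support, s.r ≤ d) (hd0 : coeff s.r s.F ≠ 0) (hcl : ¬ ∀ i, q ∣ s.r i)
    (h1h : IsMode1hCentre q S s.F) (heq : CentreBlowup.IsEquimultiplePoint q S j b s) :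
    (∀ d ∈ (CentreBlowup.step q S j b s).F.support, (CentreBlowup.step q S j b s).r ≤ d) ∧
      coeff (CentreBlowup.step q S j b s).r (CentreBlowup.step q S j b s).F ≠ 0 ∧
      (¬ ∀ i, q ∣ (CentreBlowup.step q S j b s).r i) ∧
      (CentreBlowup.step q S j b s).r.degree < s.r.degree :=
  leafStep_fibre hq hj hbj hfib s hdiv hd0 hcl h1h.1.2 (fun S' hS' hq' => h1h.2 S' ⟨hS', hq'⟩) heq

/-- **NO INFINITE FIBRE CHAIN FROM A LEAF (the fibre game is won at d = 0).** There is no infinite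
sequence of states starting at a leaf in which every step blows up a MODE-1h centre and moves to an
equimultiple point of the fibre over the origin: `|r|` would drop for ever.  This is the theorem behind
the engines' convention «monomial(d = 0) = A-WIN» for FIBRE replies; it says nothing about replies
along the centre. [OURS · counted 0] [folklore] -/
theorem no_infinite_fibre_chain {q : ℕ} (hq : 0 < q) (c : ℕ → State K) (S : ℕ → Finset (Fin 4))
    (j : ℕ → Fin 4) (b : ℕ → Fin 4 → K)
    (hleaf : (∀ d ∈ (c 0).F.support, (c 0).r ≤ d) ∧ coeff (c 0).r (c 0).F ≠ 0 ∧
      ¬ ∀ i, q ∣ (c 0).r i)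
    (hstep : ∀ k, IsMode1hCentre q (S k) (c k).F ∧ j k ∈ S k ∧ b k (j k) = 0 ∧
      (∀ i, i ∉ S k → b k i = 0) ∧ CentreBlowup.IsEquimultiplePoint q (S k) (j k) (b k) (c k) ∧
      c (k + 1) = CentreBlowup.step q (S k) (j k) (b k) (c k)) : False := by
  -- every state of the chain is a leaf …
  have hall : ∀ k, (∀ d ∈ (c k).F.support, (c k).r ≤ d) ∧ coeff (c k).r (c k).F ≠ 0 ∧
      ¬ ∀ i, q ∣ (c k).r i := by
    intro k
    induction k with
    | zero => exact hleaf
    | succ k ih =>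
      obtain ⟨h1h, hj, hbj, hfib, heq, hc⟩ := hstep k
      obtain ⟨a1, a2, a3, -⟩ := leafStep_fibre_mode1h hq hj hbj hfib (c k) ih.1 ih.2.1 ih.2.2 h1h heq
      rw [hc]
      exact ⟨a1, a2, a3⟩
  -- … so `|r|` drops at every step: impossible in `ℕ`
  have hmono : ∀ k, (c k).r.degree + k ≤ (c 0).r.degree := by
    intro k
    induction k with
    | zero => simp
    | succ k ih =>
      obtain ⟨h1h, hj, hbj, hfib, heq, hc⟩ := hstep k
      have h4 := (leafStep_fibre_mode1h hq hj hbj hfib (c k) (hall k).1 (hall k).2.1 (hall k).2.2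
        h1h heq).2.2.2
      rw [← hc] at h4
      omega
  have := hmono ((c 0).r.degree + 1)
  omega

end ClassOfRecord

end LeafStep

end Summit.ResolutionOfSingularities.ResolutionOfSingularities.Theorems.PIDim4

end
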